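import Mathlib
import Literature.Barriers.ValiantsHypothesis.AlgebraicNaturalProofs
import Literature.Computability.AlgebraicComplexity.ArithCircuitProofs
import Literature.Computability.AlgebraicComplexity.SparseCircuitBounds
import HarnessLib

/-!
# Small principal catalecticant minors are hit at the OPEN exponent `b = 2`
(crux stmt-ValiantsHypothesis-14610 side; docket 8745/8749 of seat val-np-p5)

**What is proved (unconditional; it does NOT close any item).** In FSV's framework over `ℂ`
(regime `d = n`): for every `n`, every finite injective family of exponent vectors
`u : ι ↪ ℕ^n` with `2|u_i| ≤ n` and `2|ι| + 2 ≤ n`, some `f ∈ SmallCircuits ℂ n 2` (degree `≤ n`,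
size `≤ n²`) has `det [coeff_{u_i + u_j} f]_{i,j ∈ ι} ≠ 0` (`principalMinor_hit_two`); hitting-set
form `principalMinorsSmall_two`. The companion file `…CatalecticantThree` hits ALL principal minors
(any size) with ONE witness at exponent `3`; here the witness depends on the minor but lives at the
open rung `b = 2`, for minors of size `< n/2`.

**Proof (sparse diagonal witness + parallelogram law).** Take `f_t = Σ_k t^{‖u_k‖²} x^{2u_k}`
(`‖u‖² = Σ_l u_l²`; `|ι|` monomials of degree `≤ n`, size `≤ |ι|(2n+2) ≤ n²`). Then
`coeff_{u_i+u_j} f_t = t^{‖u_k‖²}` if `u_i + u_j = 2u_k` (a "midpoint pair") and `0` otherwise, so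
`det = Σ_σ sgn σ · [all (σ i, i) midpoint pairs] · t^{Σ_i ‖u_{k_i}‖²}`. By the parallelogram law
`4‖u_{k_i}‖² = ‖u_{σ i} + u_i‖² = 2‖u_{σ i}‖² + 2‖u_i‖² - ‖u_{σ i} - u_i‖²`, summed over `i`:
`4 Σ_i ‖u_{k_i}‖² = 4 Σ_i ‖u_i‖² - Σ_i ‖u_{σ i} - u_i‖²`, so the exponent is `< E := Σ_i ‖u_i‖²`
unless `σ = 1`: the polynomial `det(t)` has coefficient `1` at `t^E`, hence is nonzero, hence some
`t ∈ ℂ` works (`Polynomial.funext`). Axioms: `propext`, `Classical.choice`, `Quot.sound`.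

Honest framing: 14610-side bookkeeping at the open rung (small rank-method minors of size `O(log N)`);
the 8749-side door "E a principal catalecticant minor of poly(N) size" stays OPEN at `b = 2`
(closed at `b ≥ 3` by `…CatalecticantThree`); nothing here bears on `VP ≠ VNP`.

References: Sylvester 1851/52 (catalecticants); [ForbesShpilkaVolk2018] §1.2, Question 6.
-/

-- layout Summits/ValiantsHypothesis/ValiantsHypothesis forces the duplicated namespace component
set_option linter.dupNamespace false

noncomputable section

namespace Summit.ValiantsHypothesis.ValiantsHypothesis.Theorems.BarrierLever.SuccinctHittingSetsForVP

open Literature.Barriers.ValiantsHypothesis Literature.Computability.AlgebraicComplexity MvPolynomial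

namespace PrincipalMinorsTwo

variable {n : ℕ}

/-- The squared Euclidean norm `‖m‖² = Σ_l m_l²` of an exponent vector. [folklore] -/
def sqNorm (m : Fin n →₀ ℕ) : ℕ := ∑ l, m l ^ 2

/-- The coordinatewise squared distance `Σ_l (a_l - b_l)²` (in `ℕ`, via `Int.natAbs`). [folklore] -/
def sqDist (a b : Fin n →₀ ℕ) : ℕ := ∑ l, ((a l : ℤ) - b l).natAbs ^ 2

/-- `‖2m‖² = 4‖m‖²`. [folklore] -/
theorem sqNorm_two_smul (m : Fin n →₀ ℕ) : sqNorm (2 • m) = 4 * sqNorm m := by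
  unfold sqNorm
  rw [Finset.mul_sum]
  refine Finset.sum_congr rfl fun l _ => ?_
  rw [Finsupp.smul_apply, smul_eq_mul]
  ring

/-- **Parallelogram law**: `‖a + b‖² + Σ_l (a_l - b_l)² = 2‖a‖² + 2‖b‖²`. [folklore] -/
theorem sqNorm_add_add_sqDist (a b : Fin n →₀ ℕ) :
    sqNorm (a + b) + sqDist a b = 2 * sqNorm a + 2 * sqNorm b := by
  unfold sqNorm sqDist
  rw [Finset.mul_sum, Finset.mul_sum, ← Finset.sum_add_distrib, ← Finset.sum_add_distrib]
  refine Finset.sum_congr rfl fun l _ => ?_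
  rw [Finsupp.add_apply]
  zify
  rw [sq_abs]
  ring

/-- `sqDist a b = 0 ↔ a = b`. [folklore] -/
theorem sqDist_eq_zero_iff (a b : Fin n →₀ ℕ) : sqDist a b = 0 ↔ a = b := by
  unfold sqDist
  rw [Finset.sum_eq_zero_iff]
  constructor
  · intro h
    ext l
    have := h l (Finset.mem_univ l)
    rw [pow_eq_zero_iff two_ne_zero, Int.natAbs_eq_zero, sub_eq_zero] at this
    exact_mod_cast this
  · rintro rfl l -
    simp

section Family

variable {ι : Type} [Fintype ι] (u : ι → (Fin n →₀ ℕ))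

/-- The exponent `E = Σ_i ‖u_i‖²` of the identity term. [folklore] -/
def topExp : ℕ := ∑ i, sqNorm (u i)

/-- **Key inequality.** If every pair `(u_{σ i}, u_i)` is a midpoint pair, `u_{σ i} + u_i = 2u_{k i}`,
then `4 Σ_i ‖u_{k i}‖² + Σ_i ‖u_{σ i} - u_i‖² = 4 Σ_i ‖u_i‖²`. [folklore] -/
theorem four_mul_sum_sqNorm_add (σ : Equiv.Perm ι) (k : ι → ι)
    (hk : ∀ i, u (σ i) + u i = 2 • u (k i)) :
    4 * ∑ i, sqNorm (u (k i)) + ∑ i, sqDist (u (σ i)) (u i) = 4 * topExp u := by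
  unfold topExp
  have h1 : 4 * ∑ i, sqNorm (u (k i)) = ∑ i, sqNorm (u (σ i) + u i) := by
    rw [Finset.mul_sum]
    exact Finset.sum_congr rfl fun i _ => by rw [hk i, sqNorm_two_smul]
  rw [h1, ← Finset.sum_add_distrib, Finset.sum_congr rfl fun i _ => sqNorm_add_add_sqDist _ _,
    Finset.sum_add_distrib, ← Finset.mul_sum, ← Finset.mul_sum,
    Equiv.sum_comp σ (fun i => sqNorm (u i))]
  ring

/-- … hence `Σ_i ‖u_{k i}‖² < Σ_i ‖u_i‖²` unless `σ = 1` (for an injective family). [folklore] -/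
theorem sum_sqNorm_lt (hinj : Function.Injective u) {σ : Equiv.Perm ι} (hσ : σ ≠ 1) (k : ι → ι)
    (hk : ∀ i, u (σ i) + u i = 2 • u (k i)) :
    ∑ i, sqNorm (u (k i)) < topExp u := by
  have h := four_mul_sum_sqNorm_add u σ k hk
  have hpos : 0 < ∑ i, sqDist (u (σ i)) (u i) := by
    by_contra h0
    apply hσ
    ext i
    have hz : sqDist (u (σ i)) (u i) = 0 := by
      have := Finset.sum_eq_zero_iff.mp (Nat.eq_zero_of_not_pos h0) i (Finset.mem_univ i)
      exact this
    simpa using hinj ((sqDist_eq_zero_iff _ _).mp hz)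
  omega

/-- The symbolic principal minor: `M[i, j] = Σ_k [u_i + u_j = 2u_k] · T^{‖u_k‖²}` over `ℂ[T]`
(the value of `coeff_{u_i+u_j}` at the witness `Σ_k T^{‖u_k‖²} x^{2u_k}`). [folklore] -/
def symbMinor : Matrix ι ι (Polynomial ℂ) :=
  Matrix.of fun i j => ∑ k, if u i + u j = 2 • u k then Polynomial.X ^ sqNorm (u k) else 0

/-- `2 •` is injective on exponent vectors. [folklore] -/
theorem two_smul_injective : Function.Injective (fun m : Fin n →₀ ℕ => 2 • m) := by
  intro a b h
  ext l
  have := congrArg (fun m : Fin n →₀ ℕ => m l) h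
  simp only [Finsupp.smul_apply, smul_eq_mul] at this
  omega

/-- An entry of the symbolic minor is `T^{‖u_k‖²}` when `u_i + u_j = 2u_k`. [folklore] -/
theorem symbMinor_apply_of_eq (hinj : Function.Injective u) {i j k : ι}
    (h : u i + u j = 2 • u k) : symbMinor u i j = Polynomial.X ^ sqNorm (u k) := by
  unfold symbMinor
  rw [Matrix.of_apply, Finset.sum_eq_single k]
  · rw [if_pos h]
  · intro k' _ hk'
    rw [if_neg]
    intro h'
    exact hk' (hinj (two_smul_injective (h'.symm.trans h)))
  · intro hk; exact absurd (Finset.mem_univ k) hk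

/-- An entry of the symbolic minor vanishes when `(i, j)` is not a midpoint pair. [folklore] -/
theorem symbMinor_apply_of_not (i j : ι) (h : ∀ k, u i + u j ≠ 2 • u k) : symbMinor u i j = 0 := by
  unfold symbMinor
  rw [Matrix.of_apply]
  exact Finset.sum_eq_zero fun k _ => if_neg (h k)

/-- The diagonal term: `∏_i M[i, i] = T^E`. [folklore] -/
theorem prod_symbMinor_diag (hinj : Function.Injective u) :
    ∏ i, symbMinor u i i = Polynomial.X ^ topExp u := by
  unfold topExp
  rw [← Finset.prod_pow_eq_pow_sum]
  exact Finset.prod_congr rfl fun i _ => symbMinor_apply_of_eq u hinj (two_smul ℕ (u i)).symm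

/-- Off the identity, the `σ`-term has no `T^E` coefficient. [folklore] -/
theorem coeff_prod_symbMinor_of_ne_one (hinj : Function.Injective u) {σ : Equiv.Perm ι}
    (hσ : σ ≠ 1) : (∏ i, symbMinor u (σ i) i).coeff (topExp u) = 0 := by
  classical
  by_cases hall : ∀ i, ∃ k, u (σ i) + u i = 2 • u k
  · choose k hk using hall
    have hprod : ∏ i, symbMinor u (σ i) i = Polynomial.X ^ ∑ i, sqNorm (u (k i)) := by
      rw [← Finset.prod_pow_eq_pow_sum]
      exact Finset.prod_congr rfl fun i _ => symbMinor_apply_of_eq u hinj (hk i)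
    rw [hprod, Polynomial.coeff_X_pow, if_neg (sum_sqNorm_lt u hinj hσ k hk).ne']
  · push Not at hall
    obtain ⟨i, hi⟩ := hall
    rw [Finset.prod_eq_zero (f := fun j => symbMinor u (σ j) j) (Finset.mem_univ i)
      (symbMinor_apply_of_not u (σ i) i hi), Polynomial.coeff_zero]

/-- **The symbolic principal minor has coefficient `1` at `T^E`**, hence is a nonzero polynomial.
[folklore] -/
theorem coeff_det_symbMinor [DecidableEq ι] (hinj : Function.Injective u) :
    (symbMinor u).det.coeff (topExp u) = 1 := by
  rw [Matrix.det_apply, Polynomial.finsetSum_coeff, Finset.sum_eq_single (1 : Equiv.Perm ι)]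
  · rw [Equiv.Perm.sign_one, one_smul]
    simp only [Equiv.Perm.coe_one, id_eq]
    rw [prod_symbMinor_diag u hinj, Polynomial.coeff_X_pow, if_pos rfl]
  · intro σ _ hσ
    rw [Polynomial.coeff_smul, coeff_prod_symbMinor_of_ne_one u hinj hσ, smul_zero]
  · intro h; exact absurd (Finset.mem_univ _) h

/-- Hence some complex `t` makes the evaluated minor nonzero. [folklore] -/
theorem exists_eval_det_symbMinor_ne_zero [DecidableEq ι] (hinj : Function.Injective u) :
    ∃ t : ℂ, ((symbMinor u).det).eval t ≠ 0 := by
  by_contra h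
  push Not at h
  have hzero : (symbMinor u).det = 0 :=
    Polynomial.funext fun t => by rw [h t, Polynomial.eval_zero]
  have := coeff_det_symbMinor u hinj
  rw [hzero, Polynomial.coeff_zero] at this
  exact zero_ne_one this

/-- The witness `f_t = Σ_k t^{‖u_k‖²} x^{2u_k}`. [folklore] -/
def witness (t : ℂ) : MvPolynomial (Fin n) ℂ := ∑ k, monomial (2 • u k) (t ^ sqNorm (u k))

/-- Its relevant coefficients are the evaluated entries of the symbolic minor. [folklore] -/
theorem coeff_witness (t : ℂ) (i j : ι) :
    coeff (u i + u j) (witness u t) = (symbMinor u i j).eval t := by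
  unfold witness symbMinor
  rw [coeff_sum, Matrix.of_apply, Polynomial.eval_finsetSum]
  refine Finset.sum_congr rfl fun k _ => ?_
  rw [coeff_monomial]
  by_cases h : u i + u j = 2 • u k
  · rw [if_pos h.symm, if_pos h, Polynomial.eval_pow, Polynomial.eval_X]
  · rw [if_neg (fun h' => h h'.symm), if_neg h, Polynomial.eval_zero]

/-- The principal minor of the witness is the evaluated symbolic determinant. [folklore] -/
theorem det_coeff_witness [DecidableEq ι] (t : ℂ) :
    (Matrix.of fun i j : ι => coeff (u i + u j) (witness u t)).det =
      ((symbMinor u).det).eval t := by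
  have hM : (Matrix.of fun i j : ι => coeff (u i + u j) (witness u t)) =
      (Polynomial.evalRingHom t).mapMatrix (symbMinor u) := by
    ext i j
    simp only [Matrix.of_apply, RingHom.mapMatrix_apply, Matrix.map_apply,
      Polynomial.coe_evalRingHom]
    exact coeff_witness u t i j
  rw [hM, ← RingHom.map_det, Polynomial.coe_evalRingHom]

/-- The witness is a small circuit of exponent `2` when `2|u_i| ≤ n` and `2|ι| + 2 ≤ n`: degree
`≤ n`, size `≤ |ι|(2n+1) + |ι| ≤ n²`. [cite: Burgisser2000, §2.1] -/
theorem witness_mem_smallCircuits (hdeg : ∀ i, 2 * (u i).degree ≤ n)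
    (hcard : 2 * Fintype.card ι + 2 ≤ n) (t : ℂ) : witness u t ∈ SmallCircuits ℂ n 2 := by
  have hd2 : ∀ k, (2 • u k).degree ≤ n := fun k => by
    rw [map_nsmul, smul_eq_mul]; exact hdeg k
  refine ⟨totalDegree_finsetSum_le fun k _ => (totalDegree_monomial_le _ _).trans (hd2 k), ?_⟩
  calc complexity (witness u t)
      ≤ ∑ k, complexity (monomial (2 • u k) (t ^ sqNorm (u k)) : MvPolynomial (Fin n) ℂ) +
          (Finset.univ : Finset ι).card := complexity_finset_sum_le _ _
    _ ≤ ∑ _k : ι, (2 * n + 1) + (Finset.univ : Finset ι).card := by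
        gcongr with k _
        exact (complexity_monomial_le _ _).trans (by have := hd2 k; omega)
    _ = Fintype.card ι * (2 * n + 1) + Fintype.card ι := by
        rw [Finset.sum_const, smul_eq_mul, Finset.card_univ]
    _ ≤ n ^ 2 := by nlinarith

end Family

end PrincipalMinorsTwo

open PrincipalMinorsTwo

/-- **Every principal catalecticant minor of size `< n/2` is hit by `SmallCircuits ℂ n 2`**: for an
injective family `u : ι → ℕ^n` with `2|u_i| ≤ n` and `2|ι| + 2 ≤ n`, some `f` of degree `≤ n` and
size `≤ n²` has `det [coeff_{u_i + u_j} f] ≠ 0` (witness `Σ_k t^{‖u_k‖²} x^{2u_k}`, `t` chosen off the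
zero set of a monic-leading determinant polynomial). [cite: ForbesShpilkaVolk2018, §1.2] -/
theorem principalMinor_hit_two {n : ℕ} {ι : Type} [Fintype ι] [DecidableEq ι]
    (u : ι → (Fin n →₀ ℕ)) (hinj : Function.Injective u) (hdeg : ∀ i, 2 * (u i).degree ≤ n)
    (hcard : 2 * Fintype.card ι + 2 ≤ n) :
    ∃ f ∈ SmallCircuits ℂ n 2, (Matrix.of fun i j : ι => MvPolynomial.coeff (u i + u j) f).det ≠ 0 := by
  obtain ⟨t, ht⟩ := exists_eval_det_symbMinor_ne_zero u hinj
  exact ⟨witness u t, witness_mem_smallCircuits u hdeg hcard t, by rwa [det_coeff_witness]⟩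

/-- **Hitting-set form at the open rung**: for every `n`, `SmallCircuits ℂ n 2` is a succinct
hitting set for the polynomials in the coefficient variables whose value at every coefficient
vector is a principal catalecticant minor `det [coeff_{u_i + u_j} f]` with `u` injective,
`2|u_i| ≤ n` and `2|ι| + 2 ≤ n`. [cite: ForbesShpilkaVolk2018, §1.2 and Question 6] -/
theorem principalMinorsSmall_two (n : ℕ) :
    IsSuccinctHittingSet (degLEMonomials n) (SmallCircuits ℂ n 2)
      {D | ∃ (ι : Type) (_ : Fintype ι) (_ : DecidableEq ι) (u : ι → (Fin n →₀ ℕ)),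
        Function.Injective u ∧ (∀ i, 2 * (u i).degree ≤ n) ∧ 2 * Fintype.card ι + 2 ≤ n ∧
        ∀ f : MvPolynomial (Fin n) ℂ, MvPolynomial.eval (coeffVector (degLEMonomials n) f) D =
          (Matrix.of fun i j : ι => MvPolynomial.coeff (u i + u j) f).det} := by
  intro D hD _
  obtain ⟨ι, _, _, u, hinj, hdeg, hcard, hD⟩ := hD
  obtain ⟨f, hf, hdet⟩ := principalMinor_hit_two u hinj hdeg hcard
  exact ⟨f, hf, by rwa [hD f]⟩

/-- … and such a minor is never an algebraically natural proof against `SmallCircuits ℂ n b`,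
`b ≥ 2` (`n ≥ 1`). [cite: ForbesShpilkaVolk2018, Thm. 4] -/
theorem not_isNaturalProof_principalMinorSmall {n b : ℕ} (hn : 1 ≤ n) (hb : 2 ≤ b)
    (𝒟 : Set (MvPolynomial (degLEMonomials n) ℂ)) {D : MvPolynomial (degLEMonomials n) ℂ}
    (hD : ∃ (ι : Type) (_ : Fintype ι) (_ : DecidableEq ι) (u : ι → (Fin n →₀ ℕ)),
      Function.Injective u ∧ (∀ i, 2 * (u i).degree ≤ n) ∧ 2 * Fintype.card ι + 2 ≤ n ∧
      ∀ f : MvPolynomial (Fin n) ℂ, MvPolynomial.eval (coeffVector (degLEMonomials n) f) D =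
        (Matrix.of fun i j : ι => MvPolynomial.coeff (u i + u j) f).det) :
    ¬ IsNaturalProof (degLEMonomials n) (SmallCircuits ℂ n b) 𝒟 D := by
  rintro ⟨-, hD0, hvan⟩
  obtain ⟨f, hf, hne⟩ := principalMinorsSmall_two n D hD hD0
  exact hne (hvan f (smallCircuits_mono ℂ hb hn hf))

end Summit.ValiantsHypothesis.ValiantsHypothesis.Theorems.BarrierLever.SuccinctHittingSetsForVP

end
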